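import Summits.QuantumFields.YangMills.Theorems.ColdStartUniversalityLatticeLangevinWilsonSpectralGap
import Mathlib.Analysis.SpecialFunctions.ImproperIntegrals
import Mathlib.MeasureTheory.Integral.ExpDecay
import HarnessLib

/-!
# Route `ColdStartUniversality` (fixed-cut-off `L²(μ_{β'})` package): THE POISSON EQUATION `−𝓛u = F` for the SZZ generator —
# the corrector `u = ∫₀^∞ P_t F dt` with `L^∞` and `L²(μ_{β'})` bounds

Helper file (seat `ym-line-csu-p1`, g16).  For the SU(2) lattice Langevin dynamics at any coupling `β'` (`μ = μ_{β'}` the Wilson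
measure, `P_t = κ_t` any realising Markov kernel family) and a continuous observable `F` with `∫ F dμ = 0`:

* `setIntegral_Ioi_comp_add_right`, `setIntegral_Ioi_eq_intervalIntegral_add` — bookkeeping on `∫_{(0,∞)}` (translation, splitting);
* ★★ `exists_poisson_solution` — there are `C, c > 0` (`L, β'` only: the Doeblin constants of `exp_mixing_szz`) such that for every
  such `F` with `|F| ≤ M` the CORRECTOR `u(x) := ∫₀^∞ κ_t F(x) dt` is well defined, continuous, `|u| ≤ M·C/c`, centred
  (`∫ u dμ = 0`) and solves the Poisson equation in semigroup (mild) form: `κ_s u − u = −∫₀ˢ κ_t F dt` for every `s ≥ 0`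
  (so `𝓛u = −F` wherever the generator is defined; Dynkin/Fubini/Chapman–Kolmogorov, no differentiability needed);
* ★ `poisson_sq_integral_le` — the `L²(μ)` bound from the spectral gap `λ = λ(L,β') > 0` of `wilson_spectralGap`: every continuous
  centred mild solution satisfies `λ · ‖u‖_{L²(μ)} ≤ ‖F‖_{L²(μ)}` (`(1 − e^{−λτ})‖u‖² ≤ ⟨u, u − P_τu⟩ = ∫₀^τ ⟨u, P_tF⟩ dt ≤ τ‖u‖‖F‖`,
  `τ ↓ 0`).

Reading: the corrector is THE tool of averaging principles (cell problem for the fast dynamics, Pavliotis–Stuart; LINE 7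
«valley_averaging») and of Kipnis–Varadhan variance bounds for time averages; here at FIXED cut-off with constants `C/c`, `1/λ` that
depend on the cut-off.  THEOREMS ONLY, no definition, no sorry.  HONEST FRAMING: fixed-cut-off plumbing; no rung, crux or summit
statement is proved; the Yang–Mills mass gap is NOT proved.
-/

set_option autoImplicit false

noncomputable section

namespace Summit.QuantumFields.YangMills.Theorems.ColdStartUniversality

open MeasureTheory ProbabilityTheory Finset Filter Set Topology
open scoped BigOperators NNReal ENNReal
open Literature.Probability.Process Literature.MathematicalPhysics.QuantumFieldTheory
open Literature.MathematicalPhysics.QuantumLattice (fundamentalRep fundamentalLatticeRep continuous_fundamentalRep)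

variable {L : ℕ} [NeZero L]

/-! ## Bookkeeping on `(0, ∞)` -/

/-- Translation on the half-line: `∫_{(0,∞)} g(t + s) dt = ∫_{(s,∞)} g(t) dt`. [folklore] -/
theorem setIntegral_Ioi_comp_add_right (g : ℝ → ℝ) (s : ℝ) :
    ∫ t in Ioi (0 : ℝ), g (t + s) = ∫ t in Ioi s, g t := by
  have h := (measurePreserving_add_right volume s).setIntegral_preimage_emb (measurableEmbedding_addRight s) g (Ioi s)
  simpa using h

/-- Splitting the half-line: for `g` integrable on `(0,∞)` and `0 ≤ s`, `∫_{(0,∞)} g = ∫₀ˢ g + ∫_{(s,∞)} g`. [folklore] -/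
theorem setIntegral_Ioi_eq_intervalIntegral_add {g : ℝ → ℝ} (hg : IntegrableOn g (Ioi (0 : ℝ))) {s : ℝ} (hs : 0 ≤ s) :
    ∫ t in Ioi (0 : ℝ), g t = (∫ t in (0 : ℝ)..s, g t) + ∫ t in Ioi s, g t := by
  rw [intervalIntegral.integral_of_le hs, ← setIntegral_union (Set.Ioc_disjoint_Ioi le_rfl) measurableSet_Ioi
    (hg.mono_set Ioc_subset_Ioi_self) (hg.mono_set (Ioi_subset_Ioi hs)), Ioc_union_Ioi_eq_Ioi hs]

/-! ## The corrector `u = ∫₀^∞ P_t F dt` -/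

/-- ★★ **The Poisson equation for the SZZ generator at a fixed cut-off.**  There are `C, c > 0` (depending on `L, β'` only) such
that for every Markov kernel family `κ` realising the transition laws, every continuous `F` with `∫ F dμ_{β'} = 0` and `|F| ≤ M`,
the corrector `u(x) = ∫_{(0,∞)} κ_t F(x) dt` is continuous, `|u| ≤ M·C/c`, `∫ u dμ_{β'} = 0`, and solves
`κ_s u(x) − u(x) = −∫₀ˢ κ_t F(x) dt` for all `s ≥ 0`, `x` (mild form of `𝓛u = −F`).
[cite: ShenZhuZhu2022, §3 (Markov semigroup P_t^L, p. 13)] [cite: RobertsRosenthal1997, Theorem 2.1] -/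
theorem exists_poisson_solution (L : ℕ) [NeZero L] (β' : ℝ) :
    ∃ C c : ℝ, 0 < C ∧ 0 < c ∧
      ∀ (κ : ℝ≥0 → Kernel (GaugeConfig 3 L (Matrix.specialUnitaryGroup (Fin 2) ℂ))
          (GaugeConfig 3 L (Matrix.specialUnitaryGroup (Fin 2) ℂ))) [∀ t, IsMarkovKernel (κ t)],
        (∀ (t : ℝ≥0) (x : GaugeConfig 3 L (Matrix.specialUnitaryGroup (Fin 2) ℂ))
          (Ω : Type) [MeasurableSpace Ω] (P : Measure Ω) [IsProbabilityMeasure P]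
          (W : ℝ≥0 → Ω → (Edge 3 L × NoiseIdx 2 → ℝ)) (hW : IsFlatBrownian W P)
          (U : ℝ≥0 → Ω → GaugeConfig 3 L (Matrix.specialUnitaryGroup (Fin 2) ℂ)),
          (∀ ω, U 0 ω = x) →
          (latticeLangevinDynamics (fundamentalLatticeRep 2) β').IsSolution (fundamentalRep (Fin 2))
            hW.natFiltration P W U →
          κ t x = P.map (U t)) →
        ∀ (F : GaugeConfig 3 L (Matrix.specialUnitaryGroup (Fin 2) ℂ) → ℝ), Continuous F →
          ∫ x, F x ∂(wilsonMeasure (d := 3) (L := L) (fundamentalRep (Fin 2)) β') = 0 →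
          ∀ M : ℝ, (∀ y, |F y| ≤ M) →
          ∃ u : GaugeConfig 3 L (Matrix.specialUnitaryGroup (Fin 2) ℂ) → ℝ, Continuous u ∧
            (∀ x, u x = ∫ t in Ioi (0 : ℝ), (∫ y, F y ∂(κ t.toNNReal x))) ∧
            (∀ x, |u x| ≤ M * C / c) ∧
            (∫ x, u x ∂(wilsonMeasure (d := 3) (L := L) (fundamentalRep (Fin 2)) β') = 0) ∧
            ∀ (s : ℝ≥0) (x : GaugeConfig 3 L (Matrix.specialUnitaryGroup (Fin 2) ℂ)),
              (∫ y, u y ∂(κ s x)) - u x = -∫ t in (0 : ℝ)..(s : ℝ), (∫ y, F y ∂(κ t.toNNReal x)) := by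
  classical
  haveI := secondCountableTopology_su2
  haveI := borelSpace_config L
  haveI : IsProbabilityMeasure (wilsonMeasure (d := 3) (L := L) (fundamentalRep (Fin 2)) β') :=
    isProbabilityMeasure_wilsonMeasure (d := 3) (L := L) (fundamentalRep (Fin 2)) (continuous_fundamentalRep (Fin 2)) β'
  obtain ⟨C, c, hC, hc, hmix⟩ := exp_mixing_transitionKernel L β'
  refine ⟨C, c, hC, hc, fun κ _ hreal F hF hF0 M hM => ?_⟩
  set μ : Measure (GaugeConfig 3 L (Matrix.specialUnitaryGroup (Fin 2) ℂ)) :=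
    wilsonMeasure (d := 3) (L := L) (fundamentalRep (Fin 2)) β' with hμ
  have hM0 : 0 ≤ M := (abs_nonneg _).trans (hM fun _ => 1)
  -- the integrand `g t x = κ_t F(x)`: jointly continuous, exponentially small
  set g : ℝ → GaugeConfig 3 L (Matrix.specialUnitaryGroup (Fin 2) ℂ) → ℝ := fun t x => ∫ y, F y ∂(κ t.toNNReal x) with hg
  have hJ : Continuous (Function.uncurry g) :=
    (continuous_transitionKernel_action β' κ hreal hF).comp
      ((continuous_real_toNNReal.comp continuous_fst).prodMk continuous_snd)
  have hgx : ∀ x, Continuous fun t => g t x := fun x => hJ.comp (continuous_id.prodMk continuous_const)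
  have hgt : ∀ t, Continuous fun x => g t x := fun t => hJ.comp (continuous_const.prodMk continuous_id)
  have hgb : ∀ t x, |g t x| ≤ M * (C * Real.exp (-c * (t.toNNReal : ℝ))) := by
    intro t x
    have h := hmix κ hreal x t.toNNReal F hF.measurable M hM
    rwa [hF0, sub_zero] at h
  set b : ℝ → ℝ := fun t => M * C * Real.exp (-c * t) with hb
  have hbi : IntegrableOn b (Ioi (0 : ℝ)) := by
    have h := (exp_neg_integrableOn_Ioi 0 hc).const_mul (M * C)
    exact h
  have hgb' : ∀ x, ∀ᵐ t ∂(volume.restrict (Ioi (0 : ℝ))), ‖g t x‖ ≤ b t := by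
    intro x
    filter_upwards [ae_restrict_mem measurableSet_Ioi] with t ht
    rw [Real.norm_eq_abs, hb]
    have h := hgb t x
    rw [Real.coe_toNNReal t (le_of_lt ht)] at h
    simpa [mul_assoc] using h
  have hgi : ∀ x, IntegrableOn (fun t => g t x) (Ioi (0 : ℝ)) := fun x =>
    Integrable.mono' hbi (hgx x).aestronglyMeasurable (hgb' x)
  -- the value of the dominating integral
  have hbint : ∫ t in Ioi (0 : ℝ), b t = M * C / c := by
    rw [hb]
    simp only [integral_const_mul]
    rw [integral_exp_mul_Ioi (by linarith : -c < 0) 0]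
    simp only [mul_zero, Real.exp_zero]
    field_simp
  -- the corrector
  set u : GaugeConfig 3 L (Matrix.specialUnitaryGroup (Fin 2) ℂ) → ℝ := fun x => ∫ t in Ioi (0 : ℝ), g t x with hu
  have huc : Continuous u :=
    continuous_of_dominated (fun x => (hgx x).aestronglyMeasurable) hgb' hbi (Eventually.of_forall hgt)
  have hub : ∀ x, |u x| ≤ M * C / c := by
    intro x
    rw [← Real.norm_eq_abs, ← hbint]
    exact norm_integral_le_of_norm_le hbi (hgb' x)
  -- Fubini on `ν × (0,∞)` for a finite measure `ν`
  have hprod : ∀ (ν : Measure (GaugeConfig 3 L (Matrix.specialUnitaryGroup (Fin 2) ℂ))) [IsFiniteMeasure ν],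
      Integrable (Function.uncurry fun (y : GaugeConfig 3 L (Matrix.specialUnitaryGroup (Fin 2) ℂ)) (t : ℝ) => g t y)
        (ν.prod (volume.restrict (Ioi (0 : ℝ)))) := by
    intro ν _
    have hmeas : AEStronglyMeasurable (Function.uncurry fun (y : GaugeConfig 3 L (Matrix.specialUnitaryGroup (Fin 2) ℂ))
        (t : ℝ) => g t y) (ν.prod (volume.restrict (Ioi (0 : ℝ)))) :=
      (hJ.comp continuous_swap).aestronglyMeasurable
    have hB : Integrable (fun p : GaugeConfig 3 L (Matrix.specialUnitaryGroup (Fin 2) ℂ) × ℝ => (1 : ℝ) * b p.2)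
        (ν.prod (volume.restrict (Ioi (0 : ℝ)))) := (integrable_const (1 : ℝ)).mul_prod hbi
    refine Integrable.mono' hB hmeas ?_
    have hs : MeasurableSet {p : GaugeConfig 3 L (Matrix.specialUnitaryGroup (Fin 2) ℂ) × ℝ | p.2 ∈ Ioi (0 : ℝ)} :=
      measurableSet_Ioi.preimage measurable_snd
    have hae : ∀ᵐ p ∂(ν.prod (volume.restrict (Ioi (0 : ℝ)))),
        p ∈ {p : GaugeConfig 3 L (Matrix.specialUnitaryGroup (Fin 2) ℂ) × ℝ | p.2 ∈ Ioi (0 : ℝ)} := by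
      rw [Measure.ae_prod_mem_iff_ae_ae_mem hs]
      exact Eventually.of_forall fun y => ae_restrict_mem measurableSet_Ioi
    filter_upwards [hae] with p hp
    have hp' : (0 : ℝ) < p.2 := hp
    rw [Real.norm_eq_abs, one_mul, hb]
    have h := hgb p.2 p.1
    rw [Real.coe_toNNReal p.2 hp'.le] at h
    show |g p.2 p.1| ≤ M * C * Real.exp (-c * p.2)
    simpa [mul_assoc] using h
  -- centred: `∫ u dμ = ∫_{(0,∞)} (∫ κ_t F dμ) dt = 0` (invariance)
  have hu0 : ∫ x, u x ∂μ = 0 := by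
    have hswap : ∫ x, (∫ t in Ioi (0 : ℝ), g t x) ∂μ = ∫ t in Ioi (0 : ℝ), (∫ x, g t x ∂μ) :=
      integral_integral_swap (hprod μ)
    show ∫ x, (∫ t in Ioi (0 : ℝ), g t x) ∂μ = 0
    rw [hswap]
    have hinv : ∀ t : ℝ, ∫ x, g t x ∂μ = 0 := fun t => by
      rw [hg]
      show ∫ x, (∫ y, F y ∂(κ t.toNNReal x)) ∂μ = 0
      rw [integral_transitionKernel_integral_eq_wilson (L := L) β' κ hreal t.toNNReal hF.measurable ⟨M, hM⟩]
      exact hF0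
    simp [hinv]
  refine ⟨u, huc, fun x => rfl, hub, hu0, fun s x => ?_⟩
  -- the Poisson equation: `κ_s u(x) = ∫_{(0,∞)} κ_{t+s} F(x) dt = ∫_{(s,∞)} κ_t F(x) dt`
  have hFi : ∀ (ν : Measure (GaugeConfig 3 L (Matrix.specialUnitaryGroup (Fin 2) ℂ))) [IsProbabilityMeasure ν],
      Integrable F ν := fun ν _ => integrable_of_continuous_of_compactSpace hF ν
  have hCK : ∀ t : ℝ, 0 < t → ∫ y, g t y ∂(κ s x) = g (t + s) x := by
    intro t ht
    rw [hg]
    show ∫ y, (∫ z, F z ∂(κ t.toNNReal y)) ∂(κ s x) = ∫ z, F z ∂(κ (t + (s : ℝ)).toNNReal x)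
    have hts : (t + (s : ℝ)).toNNReal = s + t.toNNReal := by
      rw [Real.toNNReal_add ht.le (s : ℝ≥0).coe_nonneg, Real.toNNReal_coe, add_comm]
    rw [hts, chapmanKolmogorov_szz β' κ hreal s t.toNNReal]
    haveI : IsProbabilityMeasure ((κ t.toNNReal ∘ₖ κ s) x) := by
      rw [← chapmanKolmogorov_szz β' κ hreal s t.toNNReal]; infer_instance
    exact (Kernel.integral_comp (hFi _)).symm
  have hPs : ∫ y, u y ∂(κ s x) = ∫ t in Ioi (s : ℝ), g t x := by
    have hswap : ∫ y, (∫ t in Ioi (0 : ℝ), g t y) ∂(κ s x) = ∫ t in Ioi (0 : ℝ), (∫ y, g t y ∂(κ s x)) :=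
      integral_integral_swap (hprod (κ s x))
    show ∫ y, (∫ t in Ioi (0 : ℝ), g t y) ∂(κ s x) = ∫ t in Ioi (s : ℝ), g t x
    rw [hswap, setIntegral_congr_fun measurableSet_Ioi (fun t ht => hCK t ht)]
    exact setIntegral_Ioi_comp_add_right (fun t => g t x) s
  rw [hPs]
  show (∫ t in Ioi (s : ℝ), g t x) - (∫ t in Ioi (0 : ℝ), g t x) = -∫ t in (0 : ℝ)..(s : ℝ), g t x
  rw [setIntegral_Ioi_eq_intervalIntegral_add (hgi x) (s : ℝ≥0).coe_nonneg]
  ring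

/-! ## The `L²(μ)` bound from the spectral gap -/

/-- ★ **`λ ‖u‖_{L²(μ)} ≤ ‖F‖_{L²(μ)}` for mild solutions of the Poisson equation.**  With `λ = λ(L, β') > 0` the `L²(μ_{β'})`
rate of `wilson_spectralGap`: for every realising kernel family, every continuous `F` and every continuous CENTRED `u` with
`κ_s u − u = −∫₀ˢ κ_t F dt` (all `s, x`), `λ² ∫ u² dμ_{β'} ≤ ∫ F² dμ_{β'}`.  Proof: `(1 − e^{−λτ})‖u‖² ≤ ⟨u, u − κ_τ u⟩ =
∫₀^τ ⟨u, κ_t F⟩ dt ≤ τ ‖u‖ ‖F‖` (gap, Fubini, Cauchy–Schwarz, `L²`-contraction), then `τ ↓ 0`.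
[cite: RobertsRosenthal1997, Theorem 2.1] -/
theorem poisson_sq_integral_le (L : ℕ) [NeZero L] (β' : ℝ) :
    ∃ lam : ℝ, 0 < lam ∧
      ∀ (κ : ℝ≥0 → Kernel (GaugeConfig 3 L (Matrix.specialUnitaryGroup (Fin 2) ℂ))
          (GaugeConfig 3 L (Matrix.specialUnitaryGroup (Fin 2) ℂ))) [∀ t, IsMarkovKernel (κ t)],
        (∀ (t : ℝ≥0) (x : GaugeConfig 3 L (Matrix.specialUnitaryGroup (Fin 2) ℂ))
          (Ω : Type) [MeasurableSpace Ω] (P : Measure Ω) [IsProbabilityMeasure P]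
          (W : ℝ≥0 → Ω → (Edge 3 L × NoiseIdx 2 → ℝ)) (hW : IsFlatBrownian W P)
          (U : ℝ≥0 → Ω → GaugeConfig 3 L (Matrix.specialUnitaryGroup (Fin 2) ℂ)),
          (∀ ω, U 0 ω = x) →
          (latticeLangevinDynamics (fundamentalLatticeRep 2) β').IsSolution (fundamentalRep (Fin 2))
            hW.natFiltration P W U →
          κ t x = P.map (U t)) →
        ∀ (F u : GaugeConfig 3 L (Matrix.specialUnitaryGroup (Fin 2) ℂ) → ℝ), Continuous F → Continuous u →
          ∫ x, u x ∂(wilsonMeasure (d := 3) (L := L) (fundamentalRep (Fin 2)) β') = 0 →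
          (∀ (s : ℝ≥0) (x : GaugeConfig 3 L (Matrix.specialUnitaryGroup (Fin 2) ℂ)),
            (∫ y, u y ∂(κ s x)) - u x = -∫ t in (0 : ℝ)..(s : ℝ), (∫ y, F y ∂(κ t.toNNReal x))) →
          lam ^ 2 * ∫ x, u x * u x ∂(wilsonMeasure (d := 3) (L := L) (fundamentalRep (Fin 2)) β') ≤
            ∫ x, F x * F x ∂(wilsonMeasure (d := 3) (L := L) (fundamentalRep (Fin 2)) β') := by
  classical
  haveI := secondCountableTopology_su2
  haveI := borelSpace_config L
  haveI : IsProbabilityMeasure (wilsonMeasure (d := 3) (L := L) (fundamentalRep (Fin 2)) β') :=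
    isProbabilityMeasure_wilsonMeasure (d := 3) (L := L) (fundamentalRep (Fin 2)) (continuous_fundamentalRep (Fin 2)) β'
  obtain ⟨lam, hlam, hgap⟩ := wilson_spectralGap L β'
  refine ⟨lam, hlam, fun κ _ hreal F u hF hu hu0 hP => ?_⟩
  set μ : Measure (GaugeConfig 3 L (Matrix.specialUnitaryGroup (Fin 2) ℂ)) :=
    wilsonMeasure (d := 3) (L := L) (fundamentalRep (Fin 2)) β' with hμ
  set A : ℝ := ∫ x, u x * u x ∂μ with hA
  set B : ℝ := ∫ x, F x * F x ∂μ with hB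
  have hA0 : 0 ≤ A := integral_nonneg fun x => mul_self_nonneg _
  have hB0 : 0 ≤ B := integral_nonneg fun x => mul_self_nonneg _
  obtain ⟨MF, hMF0, hMF⟩ := exists_abs_le_of_continuous hF
  obtain ⟨Mu, hMu0, hMu⟩ := exists_abs_le_of_continuous hu
  -- the integrand `g t x = κ_t F(x)`
  set g : ℝ → GaugeConfig 3 L (Matrix.specialUnitaryGroup (Fin 2) ℂ) → ℝ := fun t x => ∫ y, F y ∂(κ t.toNNReal x) with hg
  have hJ : Continuous (Function.uncurry g) :=
    (continuous_transitionKernel_action β' κ hreal hF).comp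
      ((continuous_real_toNNReal.comp continuous_fst).prodMk continuous_snd)
  have hgt : ∀ t, Continuous fun x => g t x := fun t => hJ.comp (continuous_const.prodMk continuous_id)
  have hgb : ∀ t x, |g t x| ≤ MF := fun t x => abs_integral_le_of_abs_le_of_isProbabilityMeasure hMF
  -- `|⟨u, κ_t F⟩| ≤ √A √B`
  have hinner : ∀ t : ℝ, |∫ x, u x * g t x ∂μ| ≤ Real.sqrt A * Real.sqrt B := by
    intro t
    have hCS := sq_integral_mul_le_integral_sq_mul μ hu.measurable (hgt t).measurable hMu (hgb t)
    have hcontr : ∫ x, (g t x) ^ 2 ∂μ ≤ B := by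
      have h := integral_sq_transition_le L β' κ hreal t.toNNReal hF.measurable ⟨MF, hMF⟩
      have e : ∫ x, (F x) ^ 2 ∂μ = B := integral_congr_ae (Eventually.of_forall fun x => by simp [sq])
      rw [← e]; exact h
    have hA' : ∫ x, (u x) ^ 2 ∂μ = A := integral_congr_ae (Eventually.of_forall fun x => by simp [sq])
    rw [hA'] at hCS
    have h2 : (∫ x, u x * g t x ∂μ) ^ 2 ≤ A * B :=
      hCS.trans (mul_le_mul_of_nonneg_left hcontr hA0)
    rw [← Real.sqrt_mul hA0]
    exact Real.abs_le_sqrt h2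
  -- `A − ⟨u, κ_τ u⟩ = ∫₀^τ ⟨u, κ_t F⟩ dt`
  have hK : Continuous (Function.uncurry fun (t : ℝ) (x : GaugeConfig 3 L (Matrix.specialUnitaryGroup (Fin 2) ℂ)) =>
      u x * g t x) := (hu.comp continuous_snd).mul hJ
  have hdiff : ∀ τ : ℝ, 0 ≤ τ →
      A - ∫ x, u x * (∫ y, u y ∂(κ τ.toNNReal x)) ∂μ = ∫ t in (0 : ℝ)..τ, (∫ x, u x * g t x ∂μ) := by
    intro τ hτ
    have hpt : ∀ x, u x * (∫ y, u y ∂(κ τ.toNNReal x)) = u x * u x - ∫ t in (0 : ℝ)..τ, u x * g t x := by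
      intro x
      have h := hP τ.toNNReal x
      rw [Real.coe_toNNReal τ hτ] at h
      have h' : ∫ y, u y ∂(κ τ.toNNReal x) = u x - ∫ t in (0 : ℝ)..τ, g t x := by linarith
      rw [h', mul_sub, intervalIntegral.integral_const_mul]
    have hK' : Continuous (Function.uncurry fun (x : GaugeConfig 3 L (Matrix.specialUnitaryGroup (Fin 2) ℂ)) (t : ℝ) =>
        u x * g t x) := hK.comp continuous_swap
    have hI : Continuous fun x : GaugeConfig 3 L (Matrix.specialUnitaryGroup (Fin 2) ℂ) =>
        ∫ t in (0 : ℝ)..τ, u x * g t x :=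
      intervalIntegral.continuous_parametric_intervalIntegral_of_continuous' hK' 0 τ
    have huu : Integrable (fun x => u x * u x) μ := integrable_of_continuous_of_compactSpace (hu.mul hu) μ
    rw [integral_congr_ae (Eventually.of_forall hpt), integral_sub huu
      (integrable_of_continuous_of_compactSpace hI μ), integral_intervalIntegral_swap_of_continuous μ hK hτ]
    ring
  -- the key inequality at every `τ > 0`: `(1 − e^{−λτ}) A ≤ τ √A √B`
  have hkey : ∀ τ : ℝ, 0 < τ → (1 - Real.exp (-lam * τ)) / τ * A ≤ Real.sqrt A * Real.sqrt B := by
    intro τ hτ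
    have hg' := (hgap κ hreal u hu τ.toNNReal).1 hu0
    rw [Real.coe_toNNReal τ hτ.le] at hg'
    have h1 : (1 - Real.exp (-lam * τ)) * A ≤ ∫ t in (0 : ℝ)..τ, (∫ x, u x * g t x ∂μ) := by
      rw [← hdiff τ hτ.le]; linarith
    have h2 : ∫ t in (0 : ℝ)..τ, (∫ x, u x * g t x ∂μ) ≤ Real.sqrt A * Real.sqrt B * τ := by
      have h := intervalIntegral.norm_integral_le_of_norm_le_const (a := (0 : ℝ)) (b := τ)
        (f := fun t => ∫ x, u x * g t x ∂μ) (C := Real.sqrt A * Real.sqrt B)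
        (fun t _ => by rw [Real.norm_eq_abs]; exact hinner t)
      rw [sub_zero, abs_of_pos hτ, Real.norm_eq_abs] at h
      exact (le_abs_self _).trans h
    rw [div_mul_eq_mul_div, div_le_iff₀ hτ]
    linarith
  -- `τ ↓ 0`: `(1 − e^{−λτ})/τ → λ`
  have hlim : Tendsto (fun τ : ℝ => (1 - Real.exp (-lam * τ)) / τ * A) (𝓝[>] 0) (𝓝 (lam * A)) := by
    have hD : HasDerivAt (fun τ : ℝ => 1 - Real.exp (-lam * τ)) lam 0 := by
      have h1 : HasDerivAt (fun τ : ℝ => -lam * τ) (-lam) 0 := by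
        simpa using (hasDerivAt_id (0 : ℝ)).const_mul (-lam)
      have h2 := (h1.exp).const_sub 1
      simpa using h2
    have h := hD.tendsto_slope_zero_right
    have h' : Tendsto (fun τ : ℝ => (1 - Real.exp (-lam * τ)) / τ) (𝓝[>] 0) (𝓝 lam) := by
      refine h.congr' (Eventually.of_forall fun τ => ?_)
      simp only [zero_add, mul_zero, Real.exp_zero, sub_self, sub_zero, smul_eq_mul]
      ring
    exact h'.mul_const A
  have hle : lam * A ≤ Real.sqrt A * Real.sqrt B :=
    le_of_tendsto hlim (by
      filter_upwards [self_mem_nhdsWithin] with τ hτ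
      exact hkey τ hτ)
  -- conclude: `λ² A ≤ B`
  have hsq : (lam * A) ^ 2 ≤ A * B := by
    have h := pow_le_pow_left₀ (mul_nonneg hlam.le hA0) hle 2
    rwa [mul_pow (Real.sqrt A), Real.sq_sqrt hA0, Real.sq_sqrt hB0] at h
  rcases hA0.eq_or_lt with hAz | hApos
  · rw [← hAz, mul_zero]; exact hB0
  · have : lam ^ 2 * A * A ≤ B * A := by nlinarith [hsq]
    exact le_of_mul_le_mul_right this hApos

end Summit.QuantumFields.YangMills.Theorems.ColdStartUniversality

end
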